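import Mathlib
import Summits.ValiantsHypothesis.ValiantsHypothesis.Theses.LiouvilleSarnak

/-!
# Route LiouvilleSarnak — crux `LiouvilleCutRank` (stmt-ValiantsHypothesis-14775):
# a COMPACTNESS PRINCIPLE — the crux follows from forcing prefixes of INFINITE cut words

The crux `LiouvilleCutRank`: for every `W`, for all large `n`, EVERY balanced cut `π` of the `2n` bit
positions gives a Liouville cut matrix `M_π(r,c) = λ(N_π(r,c) + 1)` of rank `≥ W`.  Its difficulty is the
uniformity over all cuts.  Write `w_π : ℕ → Bool` for the row/column word of `π` (`w_π j = true` iff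
position `j` is a row bit).  The "bad" words (words of cuts of rank `< W`) together with all their windows
form a FACTORIAL language (a window of a window is a window), so Kőnig's lemma applies:

* §1 `exists_word_of_prefixClosed` — Kőnig's lemma for Boolean words: a prefix-closed property holding for
  words of every length holds for all prefixes of ONE infinite word `t : ℕ → Bool`
  (from Mathlib's `exists_seq_forall_proj_of_forall_finite`).
* §2 ★ `exists_infiniteWord_of_not_liouvilleCutRank` — if the crux fails for `W`, there is an infinite word
  `t : ℕ → Bool` EVERY prefix of which occurs as a window `w_π(s), …, w_π(s+m-1)` of some balanced cut `π`
  (some level) with `rank M_π < W`.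
  ★★ `liouvilleCutRank_of_forcingPrefixes` — contrapositive: **if every infinite word `t` has a finite
  prefix `t|m` that FORCES rank `≥ W` (every balanced cut, at any level, containing `t|m` as a window has
  rank `≥ W`), then `LiouvilleCutRank` holds.**  No uniformity in `t` is required — the common scale `n₀(W)`
  comes for free from compactness.  Forcing prefixes are what the tree's infinite-matrix arguments produce
  (`…InterleavedUnbounded`, `…PeriodicRatio`: infinitely many distinct rows of the infinite matrix of a word
  ⟹ some finite truncation has `2^W` distinct rows ⟹ by the `2^s`-window embedding every cut containing it
  has rank `≥ W`), so the crux may be attacked ONE INFINITE WORD AT A TIME.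
* §3 ★ `liouvilleCutRank_of_longRun_of_boundedRun` — the dichotomy form: the crux follows from
  (a) LONG RUN ANYWHERE: for every `W` some run length `L` such that every balanced cut whose word has `L`
  consecutive equal letters anywhere has rank `≥ W` (OPEN — the tree's `…LongRun.le_rank_of_longRun` needs the
  run to fill almost half of a balanced window; the general form is the census's sparse-kernel statement), and
  (b) BOUNDED-RUN INFINITE WORDS: every infinite word all of whose runs are shorter than `L` has a forcing
  prefix for `W` (OPEN — the finely interleaved residual class of the census, now as a statement about single
  infinite recurrent-type words, where shift-orbit self-similarity `λ(2^s m) = (-1)^s λ(m)` is available).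

Honest framing: a reduction only; `LiouvilleCutRank` (ALL balanced cuts), `DigitalBilinearLiouville` and
`AlgebraicSarnak` stay OPEN, and nothing here bears on `VP ≠ VNP`.  No definitions.
-/

set_option linter.dupNamespace false

namespace Summit.ValiantsHypothesis.ValiantsHypothesis.Theorems.LiouvilleSarnakLiouvilleCutRank.Compactness

open Summit.ValiantsHypothesis.ValiantsHypothesis.Theses.LiouvilleSarnak (LiouvilleCutRank)

/-! ### §1 Kőnig's lemma for Boolean words -/

/-- **Kőnig's lemma for words.**  If a property `P m` of Boolean words of length `m` is closed under
restriction to shorter prefixes and holds for some word of every length, then there is an infinite word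
`t : ℕ → Bool` all of whose prefixes satisfy `P`. [folklore] -/
theorem exists_word_of_prefixClosed (P : (m : ℕ) → (Fin m → Bool) → Prop)
    (hres : ∀ (i j : ℕ) (hij : i ≤ j) (v : Fin j → Bool), P j v → P i (fun k => v (Fin.castLE hij k)))
    (hne : ∀ m, ∃ v : Fin m → Bool, P m v) :
    ∃ t : ℕ → Bool, ∀ m, P m (fun k : Fin m => t k) := by
  classical
  let α : ℕ → Type := fun m => {v : Fin m → Bool // P m v}
  haveI hnon : ∀ i, Nonempty (α i) := fun i => by
    obtain ⟨v, hv⟩ := hne i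
    exact ⟨⟨v, hv⟩⟩
  haveI hfinite : ∀ i, Finite (α i) := fun i => Subtype.finite
  let ρ : {i j : ℕ} → (hij : i ≤ j) → α j → α i := fun hij a =>
    ⟨fun k => a.1 (Fin.castLE hij k), hres _ _ hij a.1 a.2⟩
  have ρ_apply : ∀ {i j : ℕ} (hij : i ≤ j) (a : α j) (k : Fin i),
      (ρ hij a).1 k = a.1 (Fin.castLE hij k) := fun _ _ _ => rfl
  have ρ_refl : ∀ ⦃i⦄ (a : α i), ρ rfl.le a = a := by
    intro i a
    apply Subtype.ext
    funext k
    rw [ρ_apply]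
    exact congrArg a.1 (Fin.ext (by simp))
  have ρ_trans : ∀ ⦃i j k⦄ (hij : i ≤ j) (hjk : j ≤ k) (a : α k),
      ρ hij (ρ hjk a) = ρ (hij.trans hjk) a := by
    intro i j k hij hjk a
    apply Subtype.ext
    funext x
    rw [ρ_apply, ρ_apply, ρ_apply]
    exact congrArg a.1 (Fin.ext (by simp))
  have hfin : ∀ i (a : α i), {b : α (i + 1) | ρ (Nat.le_add_right i 1) b = a}.Finite :=
    fun i a => Set.toFinite _
  obtain ⟨f, hf⟩ := exists_seq_forall_proj_of_forall_finite ρ ρ_refl ρ_trans hfin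
  refine ⟨fun k => (f (k + 1)).1 ⟨k, Nat.lt_succ_self k⟩, fun m => ?_⟩
  have key : (fun k : Fin m => (f (k.1 + 1)).1 ⟨k.1, Nat.lt_succ_self k.1⟩) = (f m).1 := by
    funext k
    have h := hf (show k.1 + 1 ≤ m from k.2)
    have h' : (ρ (show k.1 + 1 ≤ m from k.2) (f m)).1 ⟨k.1, Nat.lt_succ_self _⟩ =
        (f (k.1 + 1)).1 ⟨k.1, Nat.lt_succ_self _⟩ := by rw [h]
    rw [ρ_apply] at h'
    rw [← h']
    exact congrArg (f m).1 (Fin.ext (by simp))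
  rw [key]
  exact (f m).2

/-! ### §2 The compactness principle for the crux -/

/-- ★ **An infinite bad word.**  If `LiouvilleCutRank` fails, then for some `W` there is an infinite word
`t : ℕ → Bool` every prefix `t 0, …, t (m-1)` of which occurs as a window of the row/column word of some
balanced cut `π` (at some level `n`, at some position `s`) whose Liouville cut matrix has rank `< W`.
(Kőnig's lemma: the windows of bad words form a prefix-closed family with members of every length.)
[this file] -/
theorem exists_infiniteWord_of_not_liouvilleCutRank (h : ¬ LiouvilleCutRank) :
    ∃ W : ℕ, ∃ t : ℕ → Bool, ∀ m : ℕ,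
      ∃ (n : ℕ) (π : Fin n ⊕ Fin n ≃ Fin (2 * n)) (w : ℕ → Bool) (s : ℕ),
        (∀ j : Fin (2 * n), w j = (π.symm j).isLeft) ∧
        (Matrix.of fun r c : Fin n → Bool =>
          (((ArithmeticFunction.liouville
            (Nat.ofBits (fun j : Fin (2 * n) => Sum.elim r c (π.symm j)) + 1) : ℤ) : ℂ))).rank < W ∧
        s + m ≤ 2 * n ∧ ∀ k < m, w (s + k) = t k := by
  classical
  unfold LiouvilleCutRank at h
  push Not at h
  obtain ⟨W, hW⟩ := h
  refine ⟨W, ?_⟩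
  -- the prefix-closed family: words occurring as a window of a bad cut
  let P : (m : ℕ) → (Fin m → Bool) → Prop := fun m v =>
    ∃ (n : ℕ) (π : Fin n ⊕ Fin n ≃ Fin (2 * n)) (w : ℕ → Bool) (s : ℕ),
      (∀ j : Fin (2 * n), w j = (π.symm j).isLeft) ∧
      (Matrix.of fun r c : Fin n → Bool =>
        (((ArithmeticFunction.liouville
          (Nat.ofBits (fun j : Fin (2 * n) => Sum.elim r c (π.symm j)) + 1) : ℤ) : ℂ))).rank < W ∧
      s + m ≤ 2 * n ∧ ∀ k : Fin m, w (s + k) = v k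
  have hres : ∀ (i j : ℕ) (hij : i ≤ j) (v : Fin j → Bool),
      P j v → P i (fun k => v (Fin.castLE hij k)) := by
    rintro i j hij v ⟨n, π, w, s, hw, hrank, hs, hv⟩
    exact ⟨n, π, w, s, hw, hrank, by omega, fun k => by
      simpa using hv (Fin.castLE hij k)⟩
  have hne : ∀ m, ∃ v : Fin m → Bool, P m v := by
    intro m
    obtain ⟨n, hn, π, hπ⟩ := hW m
    refine ⟨fun k => (π.symm ⟨k, by omega⟩).isLeft, n, π,
      fun j => if hj : j < 2 * n then (π.symm ⟨j, hj⟩).isLeft else false, 0,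
      fun j => by simp [j.isLt], hπ, by omega, fun k => ?_⟩
    have hk : (0 + (k : ℕ)) < 2 * n := by omega
    simp only [hk, dif_pos]
    congr 2
    ext
    simp
  obtain ⟨t, ht⟩ := exists_word_of_prefixClosed P hres hne
  refine ⟨t, fun m => ?_⟩
  obtain ⟨n, π, w, s, hw, hrank, hs, hv⟩ := ht m
  exact ⟨n, π, w, s, hw, hrank, hs, fun k hk => hv ⟨k, hk⟩⟩

/-- ★★ **Compactness principle.**  Suppose every infinite word `t : ℕ → Bool` has a FORCING PREFIX for
every `W`: some `m` such that every balanced cut `π` (any level `n`), whose row/column word `w` contains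
`t 0, …, t (m-1)` as a window `w s, …, w (s+m-1)`, has a Liouville cut matrix of rank `≥ W`.  Then
`LiouvilleCutRank` holds — the scale `n₀(W)` common to all cuts is supplied by Kőnig's lemma.
[this file] -/
theorem liouvilleCutRank_of_forcingPrefixes
    (hforce : ∀ (W : ℕ) (t : ℕ → Bool), ∃ m : ℕ,
      ∀ (n : ℕ) (π : Fin n ⊕ Fin n ≃ Fin (2 * n)) (w : ℕ → Bool) (s : ℕ),
        (∀ j : Fin (2 * n), w j = (π.symm j).isLeft) → s + m ≤ 2 * n →
        (∀ k < m, w (s + k) = t k) →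
        W ≤ (Matrix.of fun r c : Fin n → Bool =>
          (((ArithmeticFunction.liouville
            (Nat.ofBits (fun j : Fin (2 * n) => Sum.elim r c (π.symm j)) + 1) : ℤ) : ℂ))).rank) :
    LiouvilleCutRank := by
  by_contra h
  obtain ⟨W, t, ht⟩ := exists_infiniteWord_of_not_liouvilleCutRank h
  obtain ⟨m, hm⟩ := hforce W t
  obtain ⟨n, π, w, s, hw, hrank, hs, hv⟩ := ht m
  exact absurd (hm n π w s hw hs hv) (not_le.mpr hrank)

/-! ### §3 The long-run / bounded-run dichotomy -/

/-- ★ **Dichotomy form.**  `LiouvilleCutRank` follows from the conjunction of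
(a) *long run anywhere*: for every `W` a run length `L` such that every balanced cut whose row/column
word has `L` consecutive equal letters (anywhere) has rank `≥ W`; and
(b) *bounded-run infinite words*: for all `W, L`, every infinite word `t` with no `L` consecutive equal
letters (`∀ i, ∃ j, i < j < i + L, t j ≠ t i`) has a forcing prefix for `W`.
(Given `W` and `t`, either `t` has a run of length `L` starting at some `i` — then the prefix of length
`i + L` forces by (a) — or (b) applies; conclude by `liouvilleCutRank_of_forcingPrefixes`.)  Both (a) and
(b) are OPEN in general. [this file] -/
theorem liouvilleCutRank_of_longRun_of_boundedRun
    (hrun : ∀ W : ℕ, ∃ L : ℕ,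
      ∀ (n : ℕ) (π : Fin n ⊕ Fin n ≃ Fin (2 * n)) (w : ℕ → Bool) (s : ℕ),
        (∀ j : Fin (2 * n), w j = (π.symm j).isLeft) → s + L ≤ 2 * n →
        (∀ k < L, w (s + k) = w s) →
        W ≤ (Matrix.of fun r c : Fin n → Bool =>
          (((ArithmeticFunction.liouville
            (Nat.ofBits (fun j : Fin (2 * n) => Sum.elim r c (π.symm j)) + 1) : ℤ) : ℂ))).rank)
    (hbdd : ∀ (W L : ℕ) (t : ℕ → Bool), (∀ i : ℕ, ∃ j : ℕ, i < j ∧ j < i + L ∧ t j ≠ t i) →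
      ∃ m : ℕ, ∀ (n : ℕ) (π : Fin n ⊕ Fin n ≃ Fin (2 * n)) (w : ℕ → Bool) (s : ℕ),
        (∀ j : Fin (2 * n), w j = (π.symm j).isLeft) → s + m ≤ 2 * n →
        (∀ k < m, w (s + k) = t k) →
        W ≤ (Matrix.of fun r c : Fin n → Bool =>
          (((ArithmeticFunction.liouville
            (Nat.ofBits (fun j : Fin (2 * n) => Sum.elim r c (π.symm j)) + 1) : ℤ) : ℂ))).rank) :
    LiouvilleCutRank := by
  refine liouvilleCutRank_of_forcingPrefixes fun W t => ?_
  obtain ⟨L, hL⟩ := hrun W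
  by_cases hr : ∃ i : ℕ, ∀ j : ℕ, i < j → j < i + L → t j = t i
  · -- `t` has a run of length `L` starting at `i`: the prefix of length `i + L` forces
    obtain ⟨i, hi⟩ := hr
    refine ⟨i + L, fun n π w s hw hs hv => hL n π w (s + i) hw (by omega) fun k hk => ?_⟩
    have h1 : w (s + i + k) = t (i + k) := by rw [Nat.add_assoc]; exact hv (i + k) (by omega)
    have h2 : w (s + i) = t i := by simpa using hv i (by omega)
    rw [h1, h2]
    rcases Nat.eq_zero_or_pos k with hk0 | hk0
    · subst hk0; rfl
    · exact hi (i + k) (by omega) (by omega)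
  · push Not at hr
    exact hbdd W L t (fun i => by
      obtain ⟨j, hij, hjL, hne⟩ := hr i
      exact ⟨j, hij, hjL, hne⟩)

end Summit.ValiantsHypothesis.ValiantsHypothesis.Theorems.LiouvilleSarnakLiouvilleCutRank.Compactness
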